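import Summits.QuantumFields.BalabanUV.Beta.GAN24.LayerPushAntisymm
import Summits.QuantumFields.BalabanUV.Beta.GAN24.TripleWardReadout

/-!
# `BalabanUV.Beta.GAN24.Push3TransposeSymmetrise` — binder row G-an2-4 ∕ (CONV-C), W-slot CT-W, the (α) exit «use the identity, not its defect» (summit-lead RULING
# R-lead-g77-1 clause (2); the OWNER gan24-p1 g32's design note `gen32/CTW-DESIGN-ALPHA-v0.md` v0.1 §2 (α-0) «SYMMETRISE BEFORE BOUNDING», §2b «WHICH symmetry: the OPERATOR
# TRANSPOSE of the letter's KERNEL indices»): **INTERFACE REQUEST IR-α2, DELIVERED — EQUAL KERNEL LEGS COMMUTE WITH THE KERNEL-TRANSPOSE (ANTI)SYMMETRISATION**: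
# `trK (push₃ l l w S κ u) = push₃ l l w Sᵀ κ u` and `½·(P + Pᵀ) = push₃ l l w (½·(S + Sᵀ))`, `½·(P − Pᵀ) = push₃ l l w (½·(S − Sᵀ))` for `P = push₃ l l w S κ u`; a
# transpose-ANTISYMMETRIC letter pushes to a transpose-antisymmetric letter (zero diagonal — R28∕E41 (i) «`Γ(B₁;B,B) ≡ 0`» as a lemma), a symmetric one to a symmetric one;
# and the OWNER's displayed (LT)^{sym} row on `½·(push₃ T T T S + (push₃ T T T S)ᵀ)` IS the old (LT) row on the SYMMETRISED BORN LETTER `½·(S + Sᵀ)` — the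
# symmetrisation moves onto `σ_m`, where IR-α1 (p2: is `σ_m^{sym}` flux-free?) decides
# (G-an2-4 formalisation swarm → CRUX TEAM (2), leaf prover `b2b-balaban-gan24-formalise-leaf-03`, gen 64, PART 4; RULING R-gan24p1-g32-1 (C) «IR-α2 → leaf-03 ∕ leaf-01»)

NOT IN PRINT; OUR BOOKKEEPING ([folklore] leaf-03 g59's `LayerPushAntisymm.trK_push₃ ∕ locStencil_trK` (the transpose exchanges the kernel legs), leaf-01's `Push3.push₃_add ∕
push₃_sub ∕ push₃_smul ∕ push₃_neg` (additivity on the local class, homogeneity), `BalabanStepJets.locStencil_mono`, PART 1 `TripleWardReadout.exists_legDecay_legChain` (the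
literal's chain is in the class, hypothesis-free); generic `d`; 0 `def`, 0 cited facts, 0 `def … : Prop`, 0 sorry).  HONEST FRAMING (cell contract, verbatim): «discharging
`BetaPertH` makes Bałaban's UV stability UNCONDITIONAL — a real constructive-QFT result; it is NOT the continuum limit and NOT the Clay problem.»  HONEST DEPENDENCY (verbatim):
«continuum YM on T⁴ ⇐ BetaPertH ∧ nine spine estimates (0/9 proved); BetaPertH ⇐ (D1) ∧ (D4) ∧ CAP+tail; G-an2-4 gates asym, D1 and NE2/3/4.»

## Why
R28 = E41 (journal l.48673) located the literal's whole measured non-contracting (DL) component in the KERNEL-TRANSPOSE-ANTISYMMETRIC part of the born Ward-defect letter (the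
commutator word `−G·[dM, X]·G`; the symmetric word is flux-free on the gauge modes), and the OWNER's (α-0) proposes to let the consumer's own symmetrisation kill it.  For that the
symmetrisation must pass through the dressed transport.  It does, EXACTLY, because the literal's transport has EQUAL kernel legs (`push₃ T T T`): the transpose of a three-leg
push exchanges the two kernel legs and transposes the table slotwise (leaf-03 g59), so with equal kernel legs it only transposes the table.  Hence (§3) the transported letter's
(anti)symmetric part is the transport of the born letter's (anti)symmetric part, and (§4) the OWNER's displayed (LT)^{sym} hypothesis is the OLD `hLT` on `½·(σ + σᵀ)`: if p2's
IR-α1 confirms `σ_m^{sym}` flux-free ∕ co-closed, the (Q-R)^{cc} machinery of `WardRemainderEndThreeCoDress` (row (CC)) applies to it unchanged, and PART 2's triple criterion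
is void on it by `push₃_gaugeWt_table_eq_zero_of_divFree`.

## What (generic `d`; `l w` leg families `LegDecay` at blocking `N`, rate `m > 0`; `S` with `LocStencil S Cs δ`, `δ > 0`; `Sᵀ κ u := trK (S κ u)`)
* §1 **`trK_push₃_eqLegs`**: `trK (push₃ l l w S κ u) = push₃ l l w Sᵀ κ u` (leaf-03 g59's `trK_push₃` at `r = l`, the table rate lowered below `m∕2` first).
* §2 **`push₃_transposeSymm_eq`** ∕ **`push₃_transposeAntisymm_eq`**: `push₃ l l w (½·(S ± Sᵀ)) κ u = ½·(push₃ l l w S κ u ± trK (push₃ l l w S κ u))`; `push₃_eq_symm_add_antisymm`.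
* §3 **`trK_push₃_of_transposeSymm ∕ _of_transposeAntisymm`** (`Sᵀ = ±S ⟹ Pᵀ = ±P`), `push₃_apply_swap_of_transposeAntisymm` (entries: `P z x b a = −P x z a b`),
  **`push₃_diag_eq_zero_of_transposeAntisymm`** (`P x x a a = 0` — E41 (i)'s «`Γ(B₁;B,B) ≡ 0`» for ANY equal kernel legs, in particular two gauge legs).
* §4 THE LITERAL's CHAIN (hypothesis-free class, PART 1): **`smul_transposeSymm_push₃_chain_eq`** —
  `A • (½·(push₃ T T T S ν U + trK (push₃ T T T S ν U))) = A • push₃ T T T (½·(S + Sᵀ)) ν U`, `T = legChain (respStepBmSeq (toSite rr) Lc) m k` (any scalar `A`, e.g. the END's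
  `(Lc^{k+1})^{3(d+1)}`): the OWNER's (α-END-0) row (LT)^{sym} is (LT) on the symmetrised born sub-letter, token for token after one `rw`.
* §5 THE CONSUMER's CURRENCY (the OWNER g33's remark, l.48973): `sgnK_eq_self_of_isFF`, **`trK_eq_neg_iff_parityOdd_of_isFF`** (on ff-valued letters transpose-antisymmetric
  = parity-odd `trK X = −sgnK X`, the null class of an1's `tadpole_eq_zero_of_parity` ∕ the OWNER's `WSlotParityBlind`), **`trK_push₃_eq_neg_sgnK_of_transposeAntisymm`** and
  its chain form: the transport of a transpose-antisymmetric letter on equal kernel legs is PARITY-ODD at every depth.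
Identities only: NO size asserted, H-α0 NOT asserted, nothing of the consumer side (IR-α0∕α1∕α3) touched beyond naming its null class; NOTHING of (Q-R)∕(LT)∕(DIV)∕(DL)∕«T2Shape» discharged or refuted;
NEVER «G-an2-4 closed» as (CONV-C); NOT D1, NOT `BetaPertH`, NOT continuum, NOT Clay; not in print — our bookkeeping.  2026-08-23; no existing file touched.
-/

noncomputable section

open Finset
open scoped BigOperators
open Literature.MathematicalPhysics.QuantumFieldTheory
open Literature.MathematicalPhysics.QuantumFieldTheory.Balaban1983to89
open Literature.MathematicalPhysics.QuantumFieldTheory.Balaban1983to89.Beta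
open ExpKernelCalculus (MKer BiLoc)
open AffineAveraging (box toSite)
open OneStepResolventKernel (Fib LocStencil)
open BalabanStepJets (locStencil_mono)
open Summit.QuantumFields.BalabanUV.Beta.TameKernelCalculus (trK trK_apply trK_trK)
open Summit.QuantumFields.BalabanUV.Beta.GAN24.Push4Bounds (LegDecay)
open Summit.QuantumFields.BalabanUV.Beta.GAN24.Push4Iter (legChain)
open Summit.QuantumFields.BalabanUV.Beta.GAN24.Push3 (push₃ push₃_add push₃_sub push₃_smul push₃_neg)
open Summit.QuantumFields.BalabanUV.Beta.GAN24.RespStepBmDecompExact (respStepBmSeq)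
open Summit.QuantumFields.BalabanUV.Beta.GAN24.LayerPushAntisymm (trK_push₃ locStencil_trK)
open Summit.QuantumFields.BalabanUV.Beta.GAN24.TripleWardReadout (exists_legDecay_legChain)

namespace Summit.QuantumFields.BalabanUV.Beta.GAN24.Push3TransposeSymmetrise

variable {d : ℕ} {l w : Fin (d + 1) → (Fin (d + 1) → ℤ) → Fin (d + 1) → (Fin (d + 1) → ℤ) → ℝ} {N : ℕ} {Cl Cw m Cs δ : ℝ}
  {S : Fin (d + 1) → (Fin (d + 1) → ℤ) → MKer (d + 1) (Fib d)}

/-! ## §1 Equal kernel legs: the transpose of the push is the push of the slotwise transpose -/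

/-- NOT IN PRINT; OUR BOOKKEEPING.  **EQUAL KERNEL LEGS COMMUTE WITH THE KERNEL TRANSPOSE**: for `l`, `w` in leaf-01's `LegDecay` class at blocking `N` with rate `m > 0` and
`LocStencil S Cs δ` (`δ > 0`): `trK (push₃ l l w S κ u) = push₃ l l w (fun κ u ↦ trK (S κ u)) κ u` — leaf-03 g59's `trK_push₃` (the transpose exchanges the two kernel legs and
transposes the table) with both kernel legs equal; the table's rate is first lowered below `m∕2` (`locStencil_mono`), which changes no statement. -/
theorem trK_push₃_eqLegs (hl : LegDecay l N Cl m) (hw : LegDecay w N Cw m) (hm : 0 < m) (hS : LocStencil S Cs δ) (hδ : 0 < δ)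
    (κ : Fin (d + 1)) (u : Fin (d + 1) → ℤ) :
    trK (push₃ l l w S κ u) = push₃ l l w (fun κ u => trK (S κ u)) κ u := by
  have hCs : 0 ≤ Cs := (hS 0 0).nonneg (Sum.inl 0)
  have hδ' : 0 < min δ (m / 3) := lt_min hδ (by linarith)
  have hδ'm : 2 * min δ (m / 3) < m := by have := min_le_right δ (m / 3); linarith
  exact trK_push₃ hl hl hw hm (locStencil_mono hS hCs (min_le_left _ _)) hδ' hδ'm κ u

/-! ## §2 The (anti)symmetrised table pushes to the (anti)symmetrised pushed letter -/

/-- NOT IN PRINT; OUR BOOKKEEPING.  **THE SYMMETRISED TABLE**: `push₃ l l w (κ u ↦ ½·(S κ u + trK (S κ u))) κ′ u′ = ½·(push₃ l l w S κ′ u′ + trK (push₃ l l w S κ′ u′))`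
(homogeneity + additivity on the local class + §1). -/
theorem push₃_transposeSymm_eq (hl : LegDecay l N Cl m) (hw : LegDecay w N Cw m) (hm : 0 < m) (hS : LocStencil S Cs δ) (hδ : 0 < δ)
    (κ' : Fin (d + 1)) (u' : Fin (d + 1) → ℤ) :
    push₃ l l w (fun κ u => (1 / 2 : ℝ) • (S κ u + trK (S κ u))) κ' u'
      = (1 / 2 : ℝ) • (push₃ l l w S κ' u' + trK (push₃ l l w S κ' u')) := by
  have e : (fun κ u => (1 / 2 : ℝ) • (S κ u + trK (S κ u))) = fun κ u => (1 / 2 : ℝ) • ((fun κ u => S κ u + trK (S κ u)) κ u) := rfl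
  rw [e, push₃_smul, push₃_add hl hl hw hm hS (locStencil_trK hS) hδ hδ κ' u', trK_push₃_eqLegs hl hw hm hS hδ κ' u']

/-- NOT IN PRINT; OUR BOOKKEEPING.  **THE ANTISYMMETRISED TABLE**: `push₃ l l w (κ u ↦ ½·(S κ u − trK (S κ u))) κ′ u′ = ½·(push₃ l l w S κ′ u′ − trK (push₃ l l w S κ′ u′))`. -/
theorem push₃_transposeAntisymm_eq (hl : LegDecay l N Cl m) (hw : LegDecay w N Cw m) (hm : 0 < m) (hS : LocStencil S Cs δ) (hδ : 0 < δ)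
    (κ' : Fin (d + 1)) (u' : Fin (d + 1) → ℤ) :
    push₃ l l w (fun κ u => (1 / 2 : ℝ) • (S κ u - trK (S κ u))) κ' u'
      = (1 / 2 : ℝ) • (push₃ l l w S κ' u' - trK (push₃ l l w S κ' u')) := by
  have e : (fun κ u => (1 / 2 : ℝ) • (S κ u - trK (S κ u))) = fun κ u => (1 / 2 : ℝ) • ((fun κ u => S κ u - trK (S κ u)) κ u) := rfl
  rw [e, push₃_smul, push₃_sub hl hl hw hm hS (locStencil_trK hS) hδ hδ κ' u', trK_push₃_eqLegs hl hw hm hS hδ κ' u']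

/-- [folklore] The pushed letter is the sum of the pushes of the symmetrised and the antisymmetrised tables (the two previous lemmas; `½(P+Pᵀ) + ½(P−Pᵀ) = P`). -/
theorem push₃_eq_symm_add_antisymm (hl : LegDecay l N Cl m) (hw : LegDecay w N Cw m) (hm : 0 < m) (hS : LocStencil S Cs δ) (hδ : 0 < δ)
    (κ' : Fin (d + 1)) (u' : Fin (d + 1) → ℤ) :
    push₃ l l w S κ' u'
      = push₃ l l w (fun κ u => (1 / 2 : ℝ) • (S κ u + trK (S κ u))) κ' u' + push₃ l l w (fun κ u => (1 / 2 : ℝ) • (S κ u - trK (S κ u))) κ' u' := by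
  rw [push₃_transposeSymm_eq hl hw hm hS hδ, push₃_transposeAntisymm_eq hl hw hm hS hδ]
  funext x z a b
  simp only [Pi.add_apply, Pi.smul_apply, Pi.sub_apply, smul_eq_mul]
  ring

/-! ## §3 Transpose-(anti)symmetric letters push to transpose-(anti)symmetric letters; the diagonal of an antisymmetric push vanishes -/

/-- NOT IN PRINT; OUR BOOKKEEPING.  **A TRANSPOSE-SYMMETRIC LETTER PUSHES (ON EQUAL KERNEL LEGS) TO A TRANSPOSE-SYMMETRIC LETTER**: `(∀ κ u, trK (S κ u) = S κ u) ⟹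
trK (push₃ l l w S κ′ u′) = push₃ l l w S κ′ u′`. -/
theorem trK_push₃_of_transposeSymm (hl : LegDecay l N Cl m) (hw : LegDecay w N Cw m) (hm : 0 < m) (hS : LocStencil S Cs δ) (hδ : 0 < δ)
    (hsym : ∀ κ u, trK (S κ u) = S κ u) (κ' : Fin (d + 1)) (u' : Fin (d + 1) → ℤ) :
    trK (push₃ l l w S κ' u') = push₃ l l w S κ' u' := by
  rw [trK_push₃_eqLegs hl hw hm hS hδ κ' u']
  have e : (fun κ u => trK (S κ u)) = S := by funext κ u; exact hsym κ u
  rw [e]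

/-- NOT IN PRINT; OUR BOOKKEEPING.  **A TRANSPOSE-ANTISYMMETRIC LETTER PUSHES (ON EQUAL KERNEL LEGS) TO A TRANSPOSE-ANTISYMMETRIC LETTER** (R28∕E41 (i), and leaf-01 C-2's
«antisymmetry is preserved by equal-leg pushes», as a lemma): `(∀ κ u, trK (S κ u) = −S κ u) ⟹ trK (push₃ l l w S κ′ u′) = −push₃ l l w S κ′ u′`. -/
theorem trK_push₃_of_transposeAntisymm (hl : LegDecay l N Cl m) (hw : LegDecay w N Cw m) (hm : 0 < m) (hS : LocStencil S Cs δ) (hδ : 0 < δ)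
    (hanti : ∀ κ u, trK (S κ u) = -S κ u) (κ' : Fin (d + 1)) (u' : Fin (d + 1) → ℤ) :
    trK (push₃ l l w S κ' u') = -push₃ l l w S κ' u' := by
  rw [trK_push₃_eqLegs hl hw hm hS hδ κ' u']
  have e : (fun κ u => trK (S κ u)) = fun κ u => -S κ u := by funext κ u; exact hanti κ u
  rw [e, push₃_neg]

/-- NOT IN PRINT; OUR BOOKKEEPING.  Entrywise: for a transpose-antisymmetric letter, `push₃ l l w S κ′ u′ z x b a = −push₃ l l w S κ′ u′ x z a b`. -/
theorem push₃_apply_swap_of_transposeAntisymm (hl : LegDecay l N Cl m) (hw : LegDecay w N Cw m) (hm : 0 < m) (hS : LocStencil S Cs δ) (hδ : 0 < δ)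
    (hanti : ∀ κ u, trK (S κ u) = -S κ u) (κ' : Fin (d + 1)) (u' x z : Fin (d + 1) → ℤ) (a b : Fib d) :
    push₃ l l w S κ' u' z x b a = -push₃ l l w S κ' u' x z a b := by
  have h := congrFun (congrFun (congrFun (congrFun (trK_push₃_of_transposeAntisymm hl hw hm hS hδ hanti κ' u') x) z) a) b
  rw [trK_apply, Pi.neg_apply, Pi.neg_apply, Pi.neg_apply, Pi.neg_apply] at h
  exact h

/-- NOT IN PRINT; OUR BOOKKEEPING.  **THE DIAGONAL OF AN ANTISYMMETRIC PUSH VANISHES** (E41 (i) «`Γ(B₁; B, B) ≡ 0` for every `B₁, B`», for ANY equal kernel legs — in particular two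
block-indicator gauge legs — and any table leg): `(∀ κ u, trK (S κ u) = −S κ u) ⟹ push₃ l l w S κ′ u′ x x a a = 0`. -/
theorem push₃_diag_eq_zero_of_transposeAntisymm (hl : LegDecay l N Cl m) (hw : LegDecay w N Cw m) (hm : 0 < m) (hS : LocStencil S Cs δ) (hδ : 0 < δ)
    (hanti : ∀ κ u, trK (S κ u) = -S κ u) (κ' : Fin (d + 1)) (u' x : Fin (d + 1) → ℤ) (a : Fib d) :
    push₃ l l w S κ' u' x x a a = 0 := by
  have h := push₃_apply_swap_of_transposeAntisymm hl hw hm hS hδ hanti κ' u' x x a a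
  linarith

/-! ## §4 The literal's chain: the OWNER's (LT)^{sym} row is the old (LT) row on the symmetrised born sub-letter -/

section Chain

variable {Lc : ℕ} [NeZero Lc] {rr : Fin (d + 1) → ℕ}

/-- NOT IN PRINT; OUR BOOKKEEPING.  **(LT)^{sym} IS (LT) ON THE SYMMETRISED BORN SUB-LETTER** (the OWNER's `CTW-DESIGN-ALPHA` §3 (α-END-0) display, hypothesis-free class by
PART 1 `exists_legDecay_legChain`): for every in-block root, base level `m`, depth `k`, scalar `A` (the END's `(Lc^{k+1})^{3(d+1)}`), `LocStencil S Cs δ` (`δ > 0`) and slot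
`(ν, U)`, with `T = legChain (respStepBmSeq (toSite rr) Lc) m k` on all three legs,
`A • ((1∕2)·(push₃ T T T S ν U + trK (push₃ T T T S ν U))) = A • push₃ T T T (κ u ↦ ½·(S κ u + trK (S κ u))) ν U` — so `BiLoc (A • symmetrised transported letter) …`
is LITERALLY `BiLoc (A • transported symmetrised letter) …` after one `rw`: the symmetrisation moves onto `σ_m` (IR-α1's object). -/
theorem smul_transposeSymm_push₃_chain_eq (hrr : rr ∈ box (d + 1) Lc) (m k : ℕ) (A : ℝ)
    {S : Fin (d + 1) → (Fin (d + 1) → ℤ) → MKer (d + 1) (Fib d)} {Cs δ : ℝ} (hS : LocStencil S Cs δ) (hδ : 0 < δ)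
    (ν : Fin (d + 1)) (U : Fin (d + 1) → ℤ) :
    A • ((1 / 2 : ℝ) • (push₃ (legChain (respStepBmSeq (toSite rr) Lc) m k) (legChain (respStepBmSeq (toSite rr) Lc) m k)
          (legChain (respStepBmSeq (toSite rr) Lc) m k) S ν U
        + trK (push₃ (legChain (respStepBmSeq (toSite rr) Lc) m k) (legChain (respStepBmSeq (toSite rr) Lc) m k)
          (legChain (respStepBmSeq (toSite rr) Lc) m k) S ν U)))
      = A • push₃ (legChain (respStepBmSeq (toSite rr) Lc) m k) (legChain (respStepBmSeq (toSite rr) Lc) m k)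
          (legChain (respStepBmSeq (toSite rr) Lc) m k) (fun κ u => (1 / 2 : ℝ) • (S κ u + trK (S κ u))) ν U := by
  obtain ⟨CT, mT, hmT, hT⟩ := exists_legDecay_legChain hrr m k
  rw [push₃_transposeSymm_eq hT hT hmT hS hδ ν U]

/-- NOT IN PRINT; OUR BOOKKEEPING.  The antisymmetric twin: `A • (½·(P − Pᵀ)) = A • push₃ T T T (½·(S − Sᵀ)) ν U` — the (DL) component R28 located (the commutator word's
transport) is the transport of the born letter's antisymmetric part, exactly. -/
theorem smul_transposeAntisymm_push₃_chain_eq (hrr : rr ∈ box (d + 1) Lc) (m k : ℕ) (A : ℝ)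
    {S : Fin (d + 1) → (Fin (d + 1) → ℤ) → MKer (d + 1) (Fib d)} {Cs δ : ℝ} (hS : LocStencil S Cs δ) (hδ : 0 < δ)
    (ν : Fin (d + 1)) (U : Fin (d + 1) → ℤ) :
    A • ((1 / 2 : ℝ) • (push₃ (legChain (respStepBmSeq (toSite rr) Lc) m k) (legChain (respStepBmSeq (toSite rr) Lc) m k)
          (legChain (respStepBmSeq (toSite rr) Lc) m k) S ν U
        - trK (push₃ (legChain (respStepBmSeq (toSite rr) Lc) m k) (legChain (respStepBmSeq (toSite rr) Lc) m k)
          (legChain (respStepBmSeq (toSite rr) Lc) m k) S ν U)))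
      = A • push₃ (legChain (respStepBmSeq (toSite rr) Lc) m k) (legChain (respStepBmSeq (toSite rr) Lc) m k)
          (legChain (respStepBmSeq (toSite rr) Lc) m k) (fun κ u => (1 / 2 : ℝ) • (S κ u - trK (S κ u))) ν U := by
  obtain ⟨CT, mT, hmT, hT⟩ := exists_legDecay_legChain hrr m k
  rw [push₃_transposeAntisymm_eq hT hT hmT hS hδ ν U]

/-- NOT IN PRINT; OUR BOOKKEEPING.  **THE TRANSPORTED LETTER OF A TRANSPOSE-SYMMETRIC BORN LETTER IS TRANSPOSE-SYMMETRIC AT EVERY DEPTH** (so, under H-α0's split, the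
symmetrised transported letter is the transport of `σ^{sym}` and nothing of `σ^{anti}` survives symmetrisation): `(∀ κ u, trK (S κ u) = S κ u) ⟹ trK (push₃ T T T S ν U) =
push₃ T T T S ν U`; and the antisymmetric twin with a sign. -/
theorem trK_push₃_chain_of_transposeSymm (hrr : rr ∈ box (d + 1) Lc) (m k : ℕ)
    {S : Fin (d + 1) → (Fin (d + 1) → ℤ) → MKer (d + 1) (Fib d)} {Cs δ : ℝ} (hS : LocStencil S Cs δ) (hδ : 0 < δ) (hsym : ∀ κ u, trK (S κ u) = S κ u)
    (ν : Fin (d + 1)) (U : Fin (d + 1) → ℤ) :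
    trK (push₃ (legChain (respStepBmSeq (toSite rr) Lc) m k) (legChain (respStepBmSeq (toSite rr) Lc) m k) (legChain (respStepBmSeq (toSite rr) Lc) m k) S ν U)
      = push₃ (legChain (respStepBmSeq (toSite rr) Lc) m k) (legChain (respStepBmSeq (toSite rr) Lc) m k) (legChain (respStepBmSeq (toSite rr) Lc) m k) S ν U := by
  obtain ⟨CT, mT, hmT, hT⟩ := exists_legDecay_legChain hrr m k
  exact trK_push₃_of_transposeSymm hT hT hmT hS hδ hsym ν U

/-- NOT IN PRINT; OUR BOOKKEEPING.  The antisymmetric twin for the chain, with the vanishing diagonal: `(∀ κ u, trK (S κ u) = −S κ u) ⟹ push₃ T T T S ν U x x a a = 0`. -/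
theorem push₃_chain_diag_eq_zero_of_transposeAntisymm (hrr : rr ∈ box (d + 1) Lc) (m k : ℕ)
    {S : Fin (d + 1) → (Fin (d + 1) → ℤ) → MKer (d + 1) (Fib d)} {Cs δ : ℝ} (hS : LocStencil S Cs δ) (hδ : 0 < δ) (hanti : ∀ κ u, trK (S κ u) = -S κ u)
    (ν : Fin (d + 1)) (U x : Fin (d + 1) → ℤ) (a : Fib d) :
    push₃ (legChain (respStepBmSeq (toSite rr) Lc) m k) (legChain (respStepBmSeq (toSite rr) Lc) m k) (legChain (respStepBmSeq (toSite rr) Lc) m k) S ν U x x a a = 0 := by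
  obtain ⟨CT, mT, hmT, hT⟩ := exists_legDecay_legChain hrr m k
  exact push₃_diag_eq_zero_of_transposeAntisymm hT hT hmT hS hδ hanti ν U x a

end Chain

/-! ## §5 The consumer's currency: on ff-valued letters transpose-antisymmetry IS the D1 lane's parity-oddness `trK X = −sgnK X` -/

/-- [folklore] An ff-valued kernel is fixed by `sgnK` (its mixed blocks vanish; `BorderedHessian.sgnK_eq_self`). -/
theorem sgnK_eq_self_of_isFF {V : MKer (d + 1) (Fib d)} (hff : Push4.IsFF V) : BorderedHessian.sgnK V = V :=
  BorderedHessian.sgnK_eq_self (fun x y κ l => hff.2 x y (Sum.inl κ) l) (fun x y κ l => hff.1 x y κ (Sum.inl l))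

/-- NOT IN PRINT; OUR BOOKKEEPING.  **ON ff-VALUED LETTERS, TRANSPOSE-ANTISYMMETRIC = PARITY-ODD** (the OWNER g33's located remark, journal l.48973: the null class of the D1
consumer's tadpole against the sgn-symmetric co-dressed resolvent is `trK X = −sgnK X` — an1's `KernelWardRelativeEnd.tadpole_eq_zero_of_parity`; for a letter read on the
`inl` block the two notions coincide): `IsFF V → (trK V = −V ↔ trK V = −sgnK V)`. -/
theorem trK_eq_neg_iff_parityOdd_of_isFF {V : MKer (d + 1) (Fib d)} (hff : Push4.IsFF V) :
    trK V = -V ↔ trK V = -BorderedHessian.sgnK V := by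
  rw [sgnK_eq_self_of_isFF hff]

/-- NOT IN PRINT; OUR BOOKKEEPING.  **THE TRANSPORT OF A TRANSPOSE-ANTISYMMETRIC LETTER ON EQUAL KERNEL LEGS IS PARITY-ODD** — the D1 consumer's null class
(`WSlotParityBlind`'s `X` with `trK (X …) = −sgnK (X …)`, the OWNER g33 INTENT 1): `(∀ κ u, trK (S κ u) = −S κ u) ⟹ trK (push₃ l l w S κ′ u′) = −sgnK (push₃ l l w S κ′ u′)`
(§3 + the pushed letter is ff-valued, `Push3.isFF_push₃`). -/
theorem trK_push₃_eq_neg_sgnK_of_transposeAntisymm (hl : LegDecay l N Cl m) (hw : LegDecay w N Cw m) (hm : 0 < m) (hS : LocStencil S Cs δ) (hδ : 0 < δ)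
    (hanti : ∀ κ u, trK (S κ u) = -S κ u) (κ' : Fin (d + 1)) (u' : Fin (d + 1) → ℤ) :
    trK (push₃ l l w S κ' u') = -BorderedHessian.sgnK (push₃ l l w S κ' u') := by
  rw [sgnK_eq_self_of_isFF (Push3.isFF_push₃ l l w S κ' u')]
  exact trK_push₃_of_transposeAntisymm hl hw hm hS hδ hanti κ' u'

/-- NOT IN PRINT; OUR BOOKKEEPING.  The same for the literal's chain (hypothesis-free class): `(∀ κ u, trK (S κ u) = −S κ u) ⟹ trK (push₃ T T T S ν U) = −sgnK (push₃ T T T S ν U)`,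
`T = legChain (respStepBmSeq (toSite rr) Lc) m k` — the transported antisymmetric part of the born sub-letter lies in the D1 consumer's parity-odd null class at every depth. -/
theorem trK_push₃_chain_eq_neg_sgnK_of_transposeAntisymm {Lc : ℕ} [NeZero Lc] {rr : Fin (d + 1) → ℕ} (hrr : rr ∈ box (d + 1) Lc) (m k : ℕ)
    {S : Fin (d + 1) → (Fin (d + 1) → ℤ) → MKer (d + 1) (Fib d)} {Cs δ : ℝ} (hS : LocStencil S Cs δ) (hδ : 0 < δ) (hanti : ∀ κ u, trK (S κ u) = -S κ u)
    (ν : Fin (d + 1)) (U : Fin (d + 1) → ℤ) :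
    trK (push₃ (legChain (respStepBmSeq (toSite rr) Lc) m k) (legChain (respStepBmSeq (toSite rr) Lc) m k) (legChain (respStepBmSeq (toSite rr) Lc) m k) S ν U)
      = -BorderedHessian.sgnK (push₃ (legChain (respStepBmSeq (toSite rr) Lc) m k) (legChain (respStepBmSeq (toSite rr) Lc) m k)
          (legChain (respStepBmSeq (toSite rr) Lc) m k) S ν U) := by
  obtain ⟨CT, mT, hmT, hT⟩ := exists_legDecay_legChain hrr m k
  exact trK_push₃_eq_neg_sgnK_of_transposeAntisymm hT hT hmT hS hδ hanti ν U

end Summit.QuantumFields.BalabanUV.Beta.GAN24.Push3TransposeSymmetrise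

end
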